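import Mathlib
import Summits.KontsevichZagierPeriods.Zeta5Search.CasoratianClassBoundShift
import Summits.KontsevichZagierPeriods.Zeta5Search.MomentVanishing
import Summits.KontsevichZagierPeriods.Zeta5Search.MomentIntegrality
import HarnessLib

/-!
# ζ(5) search — THEOREM LB (the Casoratian class bound) is a THEOREM

Cell `pub-zeta5` (HONEST FRAMING: systematic search; no irrationality claim unless certified), typer seat
generation 8.  Discharges BY NAME gen-2 g8's `ClusterValuation.CasoratianClassBound` (REPORT-gen2-g8 §3.7, THEOREM LB;
exhaustive check there: 78,472 `(b,p,j)` with equality in 37,272):  for `b`, `b + e_j` in the Brown–Zudilin polytope, a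
prime `p ≥ 5` with `p² > b₀ + 2` and `Cas_j(b) ≠ 0`,
`v_p(Cas_j(b)) ≥ LB(b,p) = VB(b,p) + min{1 [single-pole class], 3 + E_x [multipole class], 0 [p > d]}`.
DIGIT-FREE: no leading digit is ever compared.

PROOF (§3.7 (i)–(vi), every step a tree theorem): `Cas_j = Ω-bracket − 𝒦-bracket` (`casoratian_split`);
`‖V(b)‖, ‖V(b+e_j)‖ ≤ p^{−VB(b)}` (`classNuBound` classwise, `coeffV_eq_sum_classV`, and the MONOTONICITY `ν_x(b+e_j) ≥ ν_x(b)`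
of part 1); the `𝒦`-bracket is the sum of the ROWS `𝒦_x(b⁺)V(b) − 𝒦_x(b)V(b⁺)` (`kRes_eq_sum_classK`) with
`‖𝒦_x‖ ≤ p^{−1}` (single pole, Theorem A′) resp. `p^{−(3+E_x)}` (Theorem A, `p² ∣ g_0`), classes without poles contributing
nothing, and `E_x(b⁺) ≥ E_x(b)`; the `Ω`-bracket vanishes for `p ≤ d` (`MomentVanishing`) and is `≥ VB` otherwise
(`MomentIntegral`).  With this, `RecordRayCV` (= (CV) on the whole Brown–Zudilin record ray, `recordRayCV_of`) depends on
`RecordRayDominance` alone.  Valuation bookkeeping; nothing about irrationality.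
-/

noncomputable section

open Finset

namespace Summit.KontsevichZagierPeriods.Zeta5Search.ClusterValuation

open Summit.KontsevichZagierPeriods.Zeta5Search.DualSeries (InBox)
open Summit.KontsevichZagierPeriods.Zeta5Search.WedgeDictionary (pfData coeffV coeffW dOf)
open Summit.KontsevichZagierPeriods.Zeta5Search.CasoratianValuation (InPolytope shift casoratian)
open Summit.KontsevichZagierPeriods.Zeta5Search.BigPrime (shift_zero dOf_shift momentVanishing_holds momentIntegral_holds)
open Summit.KontsevichZagierPeriods.Zeta5Search.PadicSeries

variable {p : ℕ} [hp : Fact p.Prime]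

/-- `‖Ω_p(b)‖_p ≤ 1` (the moments are `p`-integral). -/
theorem padicNorm_omegaRes_le_one (b : ℕ → ℤ) (hb : InPolytope b) (hp3 : 3 ≤ p) : padicNorm p (omegaRes b p) ≤ 1 := by
  have hμ : ∀ N, padicNorm p (momentAt b N) ≤ 1 := fun N => by
    have h1 := padicNorm_le_of_val (p := p) (x := momentAt b N) (m := 0)
      (fun h => momentIntegral_holds b N p hb hp.out hp3 h)
    simpa using h1
  have h2norm : padicNorm p (2 : ℚ) ≤ 1 := by simpa using padicNorm.of_int (p := p) 2
  rw [omegaRes_eq_moments]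
  have hA : padicNorm p (2 * momentAt b (p + 2)) ≤ 1 := by
    rw [padicNorm.mul]
    calc padicNorm p 2 * padicNorm p (momentAt b (p + 2)) ≤ 1 * 1 :=
          mul_le_mul h2norm (hμ _) (padicNorm.nonneg _) zero_le_one
      _ = 1 := one_mul 1
  calc padicNorm p (momentAt b (2 * p + 1) - 2 * momentAt b (p + 2) + momentAt b 3)
      ≤ max (padicNorm p (momentAt b (2 * p + 1) - 2 * momentAt b (p + 2))) (padicNorm p (momentAt b 3)) :=
        padicNorm.nonarchimedean
    _ ≤ max (max (padicNorm p (momentAt b (2 * p + 1))) (padicNorm p (2 * momentAt b (p + 2))))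
          (padicNorm p (momentAt b 3)) := max_le_max padicNorm.sub le_rfl
    _ ≤ 1 := max_le (max_le (hμ _) hA) (hμ _)

omit hp in
/-- `Ω_p(b) = 0` for `p ≤ d(b)+1` (moment vanishing). -/
theorem omegaRes_eq_zero (b : ℕ → ℤ) (hb : InPolytope b) (hpd : (p : ℤ) ≤ dOf b + 1) : omegaRes b p = 0 := by
  have hd0 : 0 ≤ dOf b := by have := hb.2.2; unfold dOf; linarith
  rw [omegaRes_eq_moments, momentVanishing_holds b (2 * p + 1) hb (by omega) (by push_cast; omega),
    momentVanishing_holds b (p + 2) hb (by omega) (by push_cast; omega),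
    momentVanishing_holds b 3 hb (by omega) (by push_cast; omega)]
  ring

/-- A product bound `‖x y‖ ≤ p^{e₁} p^{e₂}` from `‖x‖ ≤ p^{e₁}`, `‖y‖ ≤ p^{e₂}`. -/
theorem padicNorm_mul_le {x y : ℚ} {e₁ e₂ : ℤ} (hx : padicNorm p x ≤ (p : ℚ) ^ e₁) (hy : padicNorm p y ≤ (p : ℚ) ^ e₂) :
    padicNorm p (x * y) ≤ (p : ℚ) ^ (e₁ + e₂) := by
  rw [padicNorm.mul, zpow_add₀ (Nat.cast_ne_zero.2 hp.out.ne_zero)]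
  exact mul_le_mul hx hy (padicNorm.nonneg _) (zpow_p_nonneg _)

/-- **THEOREM LB is a theorem**: `v_p(Cas_j(b)) ≥ LB(b,p)` for every window prime. -/
theorem casoratianClassBound_holds : CasoratianClassBound := by
  intro b j p hb hj1 hj7 hb' hprime hp5 hwin hcas
  haveI : Fact p.Prime := ⟨hprime⟩
  have hp1 : (1 : ℚ) ≤ p := one_le_p
  have h0' : shift b j 0 = b 0 := shift_zero b hj1
  have hwin' : (shift b j 0 + 2 : ℤ) < (p : ℤ) ^ 2 := by rw [h0']; exact hwin
  have hbox : InBox b := hb.1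
  have hcnt : ∀ x, classPoleCount (shift b j) p x ≤ classPoleCount b p x :=
    fun x => classPoleCount_shift_le b hbox hj1 p x
  -- Step 0: some class has a pole (otherwise `V(b) = V(b⁺) = 0` and `Cas_j = 0`)
  by_cases hnone : ∀ x, x < p → classPoleCount b p x = 0
  · exfalso
    apply hcas
    have hV0 : coeffV b = 0 := by
      rw [coeffV_eq_sum_classV b hprime.pos]
      exact sum_eq_zero fun x hx => classV_eq_zero_of_noPole b hb (hnone x (mem_range.1 hx))
    have hV0' : coeffV (shift b j) = 0 := by
      rw [coeffV_eq_sum_classV (shift b j) hprime.pos]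
      refine sum_eq_zero fun x hx => classV_eq_zero_of_noPole _ hb' ?_
      have := hcnt x; have := hnone x (mem_range.1 hx); omega
    unfold casoratian
    rw [hV0, hV0']; ring
  push Not at hnone
  obtain ⟨x₀, hx₀, hc₀⟩ := hnone
  have hpole₀ : 1 ≤ classPoleCount b p x₀ := by omega
  obtain ⟨v, hv⟩ := vbMin_isSome b hx₀ hpole₀
  obtain ⟨r, hr⟩ := rowMin_isSome b hx₀ hpole₀
  have hLB : casLB b p = v + r := by simp [casLB, hv, hr]
  rw [hLB]
  -- Step (i)+(ii): the constant terms
  have hVb : padicNorm p (coeffV b) ≤ (p : ℚ) ^ (-v) :=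
    padicNorm_coeffV_le b hb hp5 hwin v fun x hx hpole => vbMin_le b hv hx hpole
  have hVb' : padicNorm p (coeffV (shift b j)) ≤ (p : ℚ) ^ (-v) :=
    padicNorm_coeffV_le (shift b j) hb' hp5 hwin' v fun x hx hpole' =>
      (vbMin_le b hv hx (le_trans hpole' (hcnt x))).trans (classNu_shift_ge b hbox hj1 hpole')
  -- Step (iii)+(iv): the rows
  have hrow : ∀ x ∈ range p,
      padicNorm p (classK (shift b j) p x * coeffV b - classK b p x * coeffV (shift b j)) ≤ (p : ℚ) ^ (-(v + r)) := by
    intro x hx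
    have hx' := mem_range.1 hx
    rcases Nat.lt_trichotomy (classPoleCount b p x) 1 with hc | hc | hc
    · -- no pole in `b`, hence none in `b⁺`
      have h0 : classPoleCount b p x = 0 := by omega
      have h0s : classPoleCount (shift b j) p x = 0 := by have := hcnt x; omega
      rw [classK_eq_zero_of_noPole b hb h0, classK_eq_zero_of_noPole _ hb' h0s, zero_mul, zero_mul, sub_zero,
        padicNorm.zero]
      exact zpow_p_nonneg _
    · -- a single-pole class of `b`
      have hr1 : r ≤ 1 := rowMin_le_one b hr hx' hc
      have hK : padicNorm p (classK b p x) ≤ (p : ℚ) ^ (-(1 : ℤ)) := padicNorm_classK_le_single b hb hp5 hwin hx' hc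
      have hK' : padicNorm p (classK (shift b j) p x) ≤ (p : ℚ) ^ (-(1 : ℤ)) := by
        rcases Nat.eq_zero_or_pos (classPoleCount (shift b j) p x) with h0s | hpos
        · rw [classK_eq_zero_of_noPole _ hb' h0s, padicNorm.zero]; exact zpow_p_nonneg _
        · exact padicNorm_classK_le_single _ hb' hp5 hwin' hx' (by have := hcnt x; omega)
      refine (padicNorm.sub (p := p)).trans (max_le ?_ ?_)
      · exact (padicNorm_mul_le hK' hVb).trans (zpow_le_zpow_right₀ hp1 (by linarith))
      · exact (padicNorm_mul_le hK hVb').trans (zpow_le_zpow_right₀ hp1 (by linarith))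
    · -- a multipole class of `b`
      have hr3 : r ≤ 3 + classExp b p x := rowMin_le_multi b hr hx' (by omega)
      have hK : padicNorm p (classK b p x) ≤ (p : ℚ) ^ (-(3 + classExp b p x)) :=
        padicNorm_classK_le_multi b hb hp5 hwin hx' (by omega)
      have hK' : padicNorm p (classK (shift b j) p x) ≤ (p : ℚ) ^ (-(3 + classExp b p x)) := by
        rcases Nat.eq_zero_or_pos (classPoleCount (shift b j) p x) with h0s | hpos
        · rw [classK_eq_zero_of_noPole _ hb' h0s, padicNorm.zero]; exact zpow_p_nonneg _
        · exact (padicNorm_classK_le_multi _ hb' hp5 hwin' hx' hpos).trans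
            (zpow_le_zpow_right₀ hp1 (by linarith [classExp_shift_ge b hbox hj1 p x]))
      refine (padicNorm.sub (p := p)).trans (max_le ?_ ?_)
      · exact (padicNorm_mul_le hK' hVb).trans (zpow_le_zpow_right₀ hp1 (by linarith))
      · exact (padicNorm_mul_le hK hVb').trans (zpow_le_zpow_right₀ hp1 (by linarith))
  have hB : padicNorm p (kRes (shift b j) p * coeffV b - kRes b p * coeffV (shift b j)) ≤ (p : ℚ) ^ (-(v + r)) := by
    rw [kRes_eq_sum_classK (shift b j) hprime.pos, kRes_eq_sum_classK b hprime.pos, sum_mul, sum_mul,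
      ← sum_sub_distrib]
    exact padicNorm.sum_le' hrow (zpow_p_nonneg _)
  -- Step (v)+(vi): the Ω-bracket and the assembly
  apply val_ge_of_padicNorm_le hcas
  rw [casoratian_split b j p]
  have hdshift : dOf (shift b j) = dOf b - 1 := dOf_shift b hj1 hj7
  by_cases hpd : (p : ℤ) ≤ dOf b
  · rw [omegaRes_eq_zero b hb (by omega), omegaRes_eq_zero (shift b j) hb' (by rw [hdshift]; omega), zero_mul,
      zero_mul, sub_zero, zero_sub, padicNorm.neg]
    exact hB
  · have hr0 : r ≤ 0 := rowMin_le_zero b hr (by push Not at hpd; exact_mod_cast hpd)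
    refine (padicNorm.sub (p := p)).trans (max_le ?_ hB)
    refine (padicNorm.sub (p := p)).trans (max_le ?_ ?_)
    · have h1 : padicNorm p (omegaRes (shift b j) p) ≤ (p : ℚ) ^ (0 : ℤ) := by
        simpa using padicNorm_omegaRes_le_one (shift b j) hb' (by omega)
      exact (padicNorm_mul_le h1 hVb).trans (zpow_le_zpow_right₀ hp1 (by linarith))
    · have h1 : padicNorm p (omegaRes b p) ≤ (p : ℚ) ^ (0 : ℤ) := by
        simpa using padicNorm_omegaRes_le_one b hb (by omega)
      exact (padicNorm_mul_le h1 hVb').trans (zpow_le_zpow_right₀ hp1 (by linarith))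

/-- **(CV) on the whole Brown–Zudilin record ray now depends on `RecordRayDominance` alone.** -/
theorem recordRayCV_of_dominance (hD : RecordRayDominance) : RecordRayCV :=
  recordRayCV_of casoratianClassBound_holds hD

end Summit.KontsevichZagierPeriods.Zeta5Search.ClusterValuation

end
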